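import Summits.CriticalPhenomena.PercolationContinuityZ3.Theorems.Transplant.PlanarSkeletonFrmFromDefs
import Summits.CriticalPhenomena.PercolationContinuityZ3.Theorems.Transplant.SkelFrmFromBChoiceCreepY3
import Summits.CriticalPhenomena.PercolationContinuityZ3.Theorems.Transplant.SkelFrmBChoiceCreepY3
import HarnessLib
import Summits.CriticalPhenomena.PercolationContinuityZ3.Theorems.Transplant.SkelFrmBChoiceDepthYW
/-!
# U-WAVE PORT (RULING D-U, lead g21 2026-08-26; WAVE-U-MANIFEST v3.0 row «SkelFrmBChoiceDepthYW» ↦ «SkelFrmFromBChoiceDepthYW») of the tree module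
# `Transplant/SkelFrmBChoiceDepthYW` onto the carrier `PlanarSkeletonFrmFrom` (frames only, cylinders connected from width `ℓ₀` on)

ORIGINAL TITLE: N2 (frames-only node `SamePDropOfSkeletonFrm₁`, OPEN) — (ζ″) at the (R-45) instance of record `BSlot.small3 = (76·s₀, 19·s₁)`: THE SECOND-AXIS DEPTH BUDGET OF RECORD `NegB.ZDYW` and `reachY_le_ZDYW` — the

builds on p205010 (kernel theorem, internal audit signed; external expert review pending) — nothing in this file uses p205010; NOTHING is claimed about the
OPEN node U `SamePDropOfSkeletonFrmFrom₁` (nor U_s / the end state).  Lane `prim-bschramm`, seat `prim-hp-8 gen 53 (U-wave port pen, family P-hp8; tool of record = p3-g26 port_u.py)`; helper file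
(`--supports stmt-CriticalPhenomena-4575 --as helper`).  PORT RULES r1–r4 of RULING D-U: declaration order and proof texts are those of the original,
byte-identical except (i) the carrier token `PlanarSkeletonFrm ↦ PlanarSkeletonFrmFrom` (binders, `namespace`/`end` lines, qualified names of twinned
declarations), (ii) carrier-FREE declarations of the original (φ-level `Skelφ…` blocks and namespace-only arithmetic residents) are NOT re-declared —
this file imports the original and `export`s the twin-free residents (POLICY T / treatment (m1)); residents whose statement mentions a twinned
constant are copied, (iii) every carrier-binding declaration keeps its explicit binder `(Φ : PlanarSkeletonFrmFrom G)` in its own signature (r2).  Docstrings and citations are the original's.  Manifest row idx 140 (level 17; flags verbatim|DEF-ROW); filed by the hp-8 lineage under RULING M-11 (family P-hp8).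
-/

open scoped Classical

noncomputable section

namespace Summit.CriticalPhenomena.PercolationContinuityZ3.Theorems.Transplant

namespace PlanarSkeletonFrmFrom

namespace NegB

open Literature.Probability.Percolation Literature.Probability.LatticeModels SimpleGraph
open SkelConc (Consts)
open Skelφ (shearUnit kgSL kgSLY kgM₁Y kgM₂Y kgE₁Y kgWm₂Y kgWp₂Y kgZY₀ kgZY₁ dS KGYRows)
open TwoAxis.Para (modulus)
open Neg

section DepthY

variable (κ : Consts) {V : Type} [DecidableEq V] [Countable V] {G : SimpleGraph V} [G.LocallyFinite] (Φ : PlanarSkeletonFrmFrom G) (t : V) (p : unitInterval)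
  (D : Skelφ.StepI.DataNS V) (g f mk : ℕ)

/- The tuple's atoms as hygiene-free local notations (they expand syntactically at each use; importers see the expanded terms). -/
set_option hygiene false in local notation "NYᵣ" => kgNYv0 κ Φ t p D g f mk (qxYQ4 κ Φ t p D g f) (WxYQ4 κ Φ t p D g f)
set_option hygiene false in local notation "qYᵣ" => kgqY κ Φ t p D g f (qxYQ4 κ Φ t p D g f)
set_option hygiene false in local notation "WYᵣ" => kgWY κ Φ t p D g f (WxYQ4 κ Φ t p D g f)
set_option hygiene false in local notation "Rᵣ" => kgR κ Φ t p D mk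
set_option hygiene false in local notation "nᵣ" => nL κ Φ t p D g f
set_option hygiene false in local notation "ℓᵣ" => ℓL κ Φ t p D g f
set_option hygiene false in local notation "hᵣ" => hL κ Φ t p D g f
set_option hygiene false in local notation "vᵣ" => vL κ Φ t p D g f
set_option hygiene false in local notation "Uᵣ" => shearUnit (nL κ Φ t p D g f) (hL κ Φ t p D g f)
set_option hygiene false in local notation "sLᵣ" => kgSL (nL κ Φ t p D g f) (ℓL κ Φ t p D g f) (hL κ Φ t p D g f)
set_option hygiene false in local notation "Kᵣ" => ((Neg.K κ : ℕ) : ℤ)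
set_option hygiene false in local notation "m1ᵣ" => kgM₁Y (nL κ Φ t p D g f) (vL κ Φ t p D g f) (kgR κ Φ t p D mk) 0 (kgWY κ Φ t p D g f (WxYQ4 κ Φ t p D g f)) (kgNYv0 κ Φ t p D g f mk (qxYQ4 κ Φ t p D g f) (WxYQ4 κ Φ t p D g f))
set_option hygiene false in local notation "m2ᵣ" => kgM₂Y (nL κ Φ t p D g f) (ℓL κ Φ t p D g f) (hL κ Φ t p D g f) (vL κ Φ t p D g f) (kgR κ Φ t p D mk) 0 (kgqY κ Φ t p D g f (qxYQ4 κ Φ t p D g f)) (kgWY κ Φ t p D g f (WxYQ4 κ Φ t p D g f)) (kgNYv0 κ Φ t p D g f mk (qxYQ4 κ Φ t p D g f) (WxYQ4 κ Φ t p D g f))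

/-- **The second-axis depth budget of record** `ZDYW := 13·((21K+3)(⌊sL⌋₊+2) + (21K+351)·n_L + 26·⌊sL⌋₊)` (a natural number, slot-free). [this work] -/
def ZDYW (κ : Consts) {V : Type} [DecidableEq V] [Countable V] {G : SimpleGraph V} [G.LocallyFinite] (Φ : PlanarSkeletonFrmFrom G) (t : V) (p : unitInterval) (D : Skelφ.StepI.DataNS V) (g : ℕ) (f : ℕ) : ℕ := 13 * ((21 * Neg.K κ + 3) * ((sLᵣ).toNat + 2) + (21 * Neg.K κ + 351) * nᵣ + 26 * (sLᵣ).toNat)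

/-- **`ZY₀ ≤ (21K + 351)·n_L`** at the tuple of record. [this work] -/
theorem ZY₀_le_W (κ : Consts) {V : Type} [DecidableEq V] [Countable V] {G : SimpleGraph V} [G.LocallyFinite] (Φ : PlanarSkeletonFrmFrom G) (t : V) (p : unitInterval) (D : Skelφ.StepI.DataNS V) (g : ℕ) (f : ℕ) (mk : ℕ) (hKq : 5 ≤ Neg.Kq κ) (hN : EqNumL κ Φ t p D g f) (hg : gFloorKG κ Φ t p D mk ≤ g) (hg2 : 40 * Neg.K κ * KS0.R'0 κ Φ t p D mk ≤ g) :
    kgZY₀ nᵣ vᵣ Rᵣ 0 WYᵣ NYᵣ m1ᵣ (kgWm₂Y nᵣ vᵣ Rᵣ 0 WYᵣ NYᵣ) (kgWp₂Y nᵣ vᵣ Rᵣ 0 WYᵣ NYᵣ) m2ᵣ ≤ (21 * Kᵣ + 351) * ((nᵣ : ℕ) : ℤ) := by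
  obtain ⟨hnR', -, -, hR1, hK40, -⟩ := valsQ_floor κ Φ t p D g f mk hN hg hg2
  have hNle : ((NYᵣ : ℕ) : ℤ) ≤ 21 * Kᵣ + 2 := by exact_mod_cast kgNYv0_le κ Φ t p D g f mk (qxYQ4 κ Φ t p D g f) (WxYQ4 κ Φ t p D g f) hN hg
  have H := kgYRows0_of κ Φ t p D g f mk (qxYQ4 κ Φ t p D g f) (WxYQ4 κ Φ t p D g f) hN hg
  obtain ⟨-, -, hE3⟩ := H.kgE₁Y_spec NYᵣ
  have hv := hN.v_le
  have hd1eq := (dec₁Y_eq_Q κ Φ t p D g f mk).1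
  have hWY := WY_eq_3 κ Φ t p D g f
  obtain ⟨-, ha1⟩ := a1Y_bounds_3 κ Φ t p D g f mk hKq hN hg hg2 NYᵣ hNle
  obtain ⟨-, ha2⟩ := a2Y_le_3 κ Φ t p D g f mk hKq hN hg hg2 NYᵣ hNle
  have hsum : ((kgWm₂Y nᵣ vᵣ Rᵣ 0 WYᵣ NYᵣ : ℕ) : ℤ) + (kgWp₂Y nᵣ vᵣ Rᵣ 0 WYᵣ NYᵣ : ℕ) = ((kgE₁Y nᵣ vᵣ Rᵣ 0 WYᵣ NYᵣ : ℕ) : ℤ) := by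
    exact_mod_cast Skelφ.kgWm₂Y_add_kgWp₂Y (n := nᵣ) (v := vᵣ) (R' := Rᵣ) (ρ := 0) (W := WYᵣ) NYᵣ
  have hRR : ((KS0.R'0 κ Φ t p D mk : ℕ) : ℤ) = ((Rᵣ : ℕ) : ℤ) := rfl
  rw [hRR] at hnR' hR1
  have hR0 : (0 : ℤ) ≤ ((Rᵣ : ℕ) : ℤ) := by linarith
  have hva : 0 ≤ |vᵣ| := abs_nonneg _
  have hN0 : (0 : ℤ) ≤ ((NYᵣ : ℕ) : ℤ) := Nat.cast_nonneg _
  have hNv : (((NYᵣ : ℕ) : ℤ) + 2) * |vᵣ| ≤ (21 * Kᵣ + 4) * ((nᵣ : ℕ) : ℤ) := mul_le_mul (by linarith) hv hva (by positivity)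
  have hNR : (((NYᵣ : ℕ) : ℤ) + 1) * ((Rᵣ : ℕ) : ℤ) ≤ (21 * Kᵣ + 3) * ((Rᵣ : ℕ) : ℤ) := mul_le_mul_of_nonneg_right (by linarith) hR0
  have h21 : (21 * Kᵣ + 3) * ((Rᵣ : ℕ) : ℤ) ≤ 40 * Kᵣ * ((Rᵣ : ℕ) : ℤ) := mul_le_mul_of_nonneg_right (by linarith) hR0
  have hab : ((((m1ᵣ : ℕ) : ℤ)) + ((m2ᵣ : ℕ) : ℤ) + 2) * (((Rᵣ : ℕ) : ℤ) + 0 + |vᵣ|) ≤ 240 * (((Rᵣ : ℕ) : ℤ) + ((nᵣ : ℕ) : ℤ)) := by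
    exact mul_le_mul (by linarith) (by linarith) (by positivity) (by norm_num)
  have h105 : 241 * ((Rᵣ : ℕ) : ℤ) ≤ 40 * Kᵣ * ((Rᵣ : ℕ) : ℤ) := mul_le_mul_of_nonneg_right (by linarith) hR0
  unfold Skelφ.kgZY₀
  push_cast at hsum ⊢
  linarith

/-- **`ZY₁ ≤ 26·sL`** at the tuple of record. [this work] -/
theorem ZY₁_le_W (κ : Consts) {V : Type} [DecidableEq V] [Countable V] {G : SimpleGraph V} [G.LocallyFinite] (Φ : PlanarSkeletonFrmFrom G) (t : V) (p : unitInterval) (D : Skelφ.StepI.DataNS V) (g : ℕ) (f : ℕ) (mk : ℕ) (hKq : 5 ≤ Neg.Kq κ) (hN : EqNumL κ Φ t p D g f) (hg : gFloorKG κ Φ t p D mk ≤ g) (hg2 : 40 * Neg.K κ * KS0.R'0 κ Φ t p D mk ≤ g) :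
    kgZY₁ nᵣ ℓᵣ hᵣ Rᵣ 0 qYᵣ NYᵣ m1ᵣ m2ᵣ ≤ 26 * sLᵣ := by
  obtain ⟨hn1, -⟩ := one_le_of_eqNumL κ Φ t p D g f hN
  obtain ⟨-, hs40, hbig, hR1, hK40, -⟩ := valsQ_floor κ Φ t p D g f mk hN hg hg2
  have hNle : ((NYᵣ : ℕ) : ℤ) ≤ 21 * Kᵣ + 2 := by exact_mod_cast kgNYv0_le κ Φ t p D g f mk (qxYQ4 κ Φ t p D g f) (WxYQ4 κ Φ t p D g f) hN hg
  obtain ⟨-, ha1⟩ := a1Y_bounds_3 κ Φ t p D g f mk hKq hN hg hg2 NYᵣ hNle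
  obtain ⟨-, ha2⟩ := a2Y_le_3 κ Φ t p D g f mk hKq hN hg hg2 NYᵣ hNle
  have hq := kgqY_qxYQ4 κ Φ t p D g f hN
  have hP1 := Skelφ.natDiv_le_kgSLY hn1 ℓᵣ hᵣ
  rw [kgSLY_eq_kgSL] at hP1
  have hdS : ((dS nᵣ ℓᵣ hᵣ : ℕ) : ℤ) ≤ 2 := by exact_mod_cast Skelφ.dS_le_two _ _ _
  have hU : 0 < Uᵣ := by unfold Skelφ.shearUnit; omega
  have h3L : ((3 * (nᵣ * ℓᵣ) / Uᵣ : ℕ) : ℤ) ≤ ((3 * (nᵣ * ℓᵣ / Uᵣ) + 2 : ℕ) : ℤ) := by exact_mod_cast Skelφ.natDiv_three_le (nᵣ * ℓᵣ) Uᵣ hU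
  have h80 : 80 ≤ Neg.K κ := by have := Neg.K_eq κ; omega
  have hK80 : (80 : ℤ) ≤ Kᵣ := by exact_mod_cast h80
  have hRR : ((KS0.R'0 κ Φ t p D mk : ℕ) : ℤ) = ((Rᵣ : ℕ) : ℤ) := rfl
  rw [hRR] at hs40 hR1
  have hR0 : (0 : ℤ) ≤ ((Rᵣ : ℕ) : ℤ) := by linarith
  have hN0 : (0 : ℤ) ≤ ((NYᵣ : ℕ) : ℤ) := Nat.cast_nonneg _
  have hNR : (((NYᵣ : ℕ) : ℤ) + 1) * ((Rᵣ : ℕ) : ℤ) ≤ (21 * Kᵣ + 3) * ((Rᵣ : ℕ) : ℤ) := mul_le_mul_of_nonneg_right (by linarith) hR0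
  have hNd : (((NYᵣ : ℕ) : ℤ) + 1) * ((dS nᵣ ℓᵣ hᵣ : ℕ) : ℤ) ≤ (((NYᵣ : ℕ) : ℤ) + 1) * 2 := mul_le_mul_of_nonneg_left hdS (by positivity)
  have hab : ((((m1ᵣ : ℕ) : ℤ)) + ((m2ᵣ : ℕ) : ℤ) + 2) * (((Rᵣ : ℕ) : ℤ) + 0) ≤ 240 * ((Rᵣ : ℕ) : ℤ) := by
    exact mul_le_mul (by linarith) (by linarith) (by positivity) (by norm_num)
  have hKR80 : 80 * ((Rᵣ : ℕ) : ℤ) ≤ Kᵣ * ((Rᵣ : ℕ) : ℤ) := mul_le_mul_of_nonneg_right hK80 hR0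
  have hKKR : Kᵣ ≤ Kᵣ * ((Rᵣ : ℕ) : ℤ) := le_mul_of_one_le_right (by linarith) hR1
  unfold Skelφ.kgZY₁
  rw [hq]
  push_cast at hP1 h3L ⊢
  linarith

/-- **THE `HY` DEPTH ROW's LEFT-HAND SIDE IS `≤ ZDYW`**: `13·((N+1)·P + ZY₀ + ZY₁) ≤ ZDYW` at the tuple of record. [this work] -/
theorem reachY_le_ZDYW (κ : Consts) {V : Type} [DecidableEq V] [Countable V] {G : SimpleGraph V} [G.LocallyFinite] (Φ : PlanarSkeletonFrmFrom G) (t : V) (p : unitInterval) (D : Skelφ.StepI.DataNS V) (g : ℕ) (f : ℕ) (mk : ℕ) (hKq : 5 ≤ Neg.Kq κ) (hN : EqNumL κ Φ t p D g f) (hg : gFloorKG κ Φ t p D mk ≤ g) (hg2 : 40 * Neg.K κ * KS0.R'0 κ Φ t p D mk ≤ g) :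
    13 * ((((NYᵣ : ℕ) : ℤ) + 1) * ((nᵣ * ℓᵣ / Uᵣ + 1 : ℕ) : ℤ) + kgZY₀ nᵣ vᵣ Rᵣ 0 WYᵣ NYᵣ m1ᵣ (kgWm₂Y nᵣ vᵣ Rᵣ 0 WYᵣ NYᵣ) (kgWp₂Y nᵣ vᵣ Rᵣ 0 WYᵣ NYᵣ) m2ᵣ + kgZY₁ nᵣ ℓᵣ hᵣ Rᵣ 0 qYᵣ NYᵣ m1ᵣ m2ᵣ) ≤ ((ZDYW κ Φ t p D g f : ℕ) : ℤ) := by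
  obtain ⟨hn1, -⟩ := one_le_of_eqNumL κ Φ t p D g f hN
  obtain ⟨-, -, hbig, -, hK40, -⟩ := valsQ_floor κ Φ t p D g f mk hN hg hg2
  have hNle : ((NYᵣ : ℕ) : ℤ) ≤ 21 * Kᵣ + 2 := by exact_mod_cast kgNYv0_le κ Φ t p D g f mk (qxYQ4 κ Φ t p D g f) (WxYQ4 κ Φ t p D g f) hN hg
  have h0 := ZY₀_le_W κ Φ t p D g f mk hKq hN hg hg2
  have h1 := ZY₁_le_W κ Φ t p D g f mk hKq hN hg hg2
  have hP1 := Skelφ.natDiv_le_kgSLY hn1 ℓᵣ hᵣ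
  rw [kgSLY_eq_kgSL] at hP1
  have hs0 : 0 ≤ sLᵣ := by linarith
  push_cast at hP1
  have hP0 : (0 : ℤ) ≤ ((nᵣ : ℕ) : ℤ) * ℓᵣ / (Uᵣ : ℕ) + 1 := by
    have : (0 : ℤ) ≤ ((nᵣ : ℕ) : ℤ) * ℓᵣ / (Uᵣ : ℕ) := Int.ediv_nonneg (by positivity) (by positivity)
    linarith
  have hNP : (((NYᵣ : ℕ) : ℤ) + 1) * (((nᵣ : ℕ) : ℤ) * ℓᵣ / (Uᵣ : ℕ) + 1) ≤ (21 * Kᵣ + 3) * (sLᵣ + 2) := mul_le_mul (by linarith) (by linarith) hP0 (by positivity)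
  unfold ZDYW
  push_cast
  rw [Int.toNat_of_nonneg hs0]
  linarith

end DepthY

end NegB

end PlanarSkeletonFrmFrom

end Summit.CriticalPhenomena.PercolationContinuityZ3.Theorems.Transplant

end
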